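import Literature.Claims.NS.Tennant2025
import Literature.Analysis.FluidPDE.GavrilovSteadyEulerProofs
import Literature.Analysis.FluidPDE.LittlewoodPaleyFields
import Literature.Analysis.FluidPDE.TaoEnstrophyLocalisation
import HarnessLib

/-!
# C89 `Tennant2025` — kernel refutation of the viscous gain (A.6) p.14 / Prop 2.2 (2.3) p.4
# (`Step_A6`, with `Step_A5` and the assembled slice `CoerciveSlice` of Thm 2.5 / Thm A.5)

Cell `ns-claims` (D-0090 NS-CLAIMS SWEEP), claim C89; typed skeleton `Literature.Claims.NS.Tennant2025`
(p492873, typist-2 g3). Text of record: W. Tennant, *Global Regularity of 3D Navier–Stokes: Helical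
Null-Form, Coifman–Meyer Estimate, and Compactness–Rigidity Closure in Ḃ^{1/2}_{2,1}*, figshare
30045250 v4 (2025) [Tennant2025]: Prop 2.2 (2.3) p.4 l.87–96 «d/dt M(t) + c₀(a,b,λ) ν ‖u(t)‖²_H ≤
S_near(t) + S_trans(t) … The viscous contribution produces the H-gain; the logarithm is absorbed
dyadically (Lemma 2.3)», derived in App. A as (A.5)–(A.6) p.14 l.38–69 «Visc ≤ −c₀(a,b,λ) ν ‖u‖²_H»,
with `‖f‖²_H = Σ_j log(2+2^j) 2^{3j} ‖Δ_j f‖²₂` (Def 2.1 p.4). Refuter of record ns-claims-refuter-6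
(PREDICTED-R 03:53:15Z before opening the skeleton); the typist's HAND-OFF attack map (a)/(c) names the
same dilation mechanism; filed by the salvage lane (conv. (b)).

WHAT IS PROVED (all three by ONE countermodel family, the dilates `U(2^k ·)`, `k → −∞`, of Gavrilov's
smooth compactly supported divergence-free field `U ≠ 0` — tree theorem
`gavrilov_compact_steady_euler_holds` — which has a non-zero Littlewood–Paley block by the tree's
`‖v‖²₂ ≤ 2 Σ_j ‖Δ_j v‖²₂`):
* `not_Step_A6 : ¬ Step_A6` (THE LOCATOR, (A.6) p.14 = the viscous half of (2.3)): the blocks obey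
  `Δ_j(u(2^k ·)) = (Δ_{j−k} u)(2^k ·)` exactly (`blockFn_dil`, kernel scaling `K_j = 2^{3j} K₀(2^j ·)`),
  so `Visc` scales EXACTLY like `2^k` (`viscForm_dil`; shifts of `∑'` over `ℤ` need no summability),
  while the block `j = i₀ + k` alone gives `‖u(2^k ·)‖²_H ≥ log 2 · 2^{3 i₀} ‖Δ_{i₀} u‖²₂`
  (`hNormE_dil_ge`); `k → −∞` contradicts `c₀ ν ‖·‖²_H ≤ −Visc` (degree 3 + log against degree 4 at
  low frequencies: the honest viscous weight of `a 2^{2j}‖∇u_j‖²` is `a 2^{4j}`, not Lemma 2.3's `a 2^{2j}`).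
* `not_Step_A5 : ¬ Step_A5` ((A.5) p.14), for free from the skeleton's `stepA6_of_L23_A5 step_L23_holds`.
* `not_CoerciveSlice : ¬ CoerciveSlice` (Thm 2.5 p.6 / Thm A.5 p.15 at one time slice, the display
  `coerciveSlice_of_steps` assembles): `Nonlin` is exactly INVARIANT under `u ↦ u(2^k ·)` (`nonlinForm_dil`)
  and odd under `u ↦ −u` (`nonlinForm_neg`); with the sign `Nonlin ≥ 0` the same limit kills it.

Closed terms; axioms `propext`, `Classical.choice`, `Quot.sound`.

WHAT THIS IS NOT: not a claim about NS regularity or blow-up; not a claim about any author beyond the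
typed locator.
-/

-- The summit's canonical theorem namespace repeats the summit name (single-conjunct summit).
set_option linter.dupNamespace false
noncomputable section
open Set Function MeasureTheory Filter Topology
open scoped ContDiff RealInnerProductSpace ENNReal NNReal

namespace Summit.NavierStokesRegularity.NavierStokesRegularity.Theorems.Tennant2025

open Literature.Analysis.FunctionSpaces Literature.Analysis.FluidPDE Literature.Claims.NS.Tennant2025

/-- `2^k > 0`. -/
theorem dyk_pos (k : ℤ) : 0 < dy k := zpow_pos two_pos k
/-- `2^{j+k} = 2^j 2^k`. -/
theorem dy_add (j k : ℤ) : dy (j + k) = dy j * dy k := zpow_add₀ two_ne_zero j k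
/-- The dilation `v ↦ v(2^k ·)` (no amplitude factor). -/
def dil (k : ℤ) (v : E3 → E3) : E3 → E3 := fun x => v (dy k • x)
/-- `x ↦ 2^k x` as a continuous linear automorphism of `ℝ³`. -/
def dilEquiv (k : ℤ) : E3 ≃L[ℝ] E3 :=
  ContinuousLinearEquiv.equivOfInverse (dy k • ContinuousLinearMap.id ℝ E3)
    ((dy k)⁻¹ • ContinuousLinearMap.id ℝ E3)
    (fun x => by simp [smul_smul, (dyk_pos k).ne'])
    (fun x => by simp [smul_smul, (dyk_pos k).ne'])
/-- `dilEquiv k x = 2^k • x`. -/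
@[simp] theorem dilEquiv_apply (k : ℤ) (x : E3) : dilEquiv k x = dy k • x := rfl
/-- `dil k v = v ∘ dilEquiv k`. -/
theorem dil_eq_comp (k : ℤ) (v : E3 → E3) : dil k v = v ∘ (dilEquiv k) := rfl
/-- Chain rule for the dilation (no differentiability needed: `dilEquiv k` is an isomorphism). -/
theorem fderiv_dil (k : ℤ) (v : E3 → E3) (x : E3) :
    fderiv ℝ (dil k v) x = dy k • fderiv ℝ v (dy k • x) := by
  rw [dil_eq_comp, (dilEquiv k).comp_right_fderiv]; ext y; simp
/-- Test fields are closed under dilation. -/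
theorem isTestField_dil (k : ℤ) {v : E3 → E3} (hv : IsTestField v) : IsTestField (dil k v) := by
  obtain ⟨h1, h2, h3⟩ := hv
  refine ⟨?_, ?_, ?_⟩
  · rw [dil_eq_comp]; exact h1.comp (dilEquiv k).contDiff
  · rw [dil_eq_comp]; exact h2.comp_homeomorph (dilEquiv k).toHomeomorph
  · intro x
    have := h3 (dy k • x)
    unfold NSWave0.divergence at this ⊢
    rw [fderiv_dil]; simp [this]
/-- Test fields are closed under `v ↦ -v`. -/
theorem isTestField_neg {v : E3 → E3} (hv : IsTestField v) : IsTestField (-v) := by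
  obtain ⟨h1, h2, h3⟩ := hv
  refine ⟨h1.neg, h2.neg, fun x => ?_⟩
  have := h3 x
  unfold NSWave0.divergence at this ⊢
  rw [fderiv_neg]; simp [this]
/-- Kernel scaling between levels `j` and `j - k`: `K_j(t) = 2^{3k} K_{j-k}(2^k t)`. -/
theorem blockKernel_shift (j k : ℤ) (t : E3) :
    blockKernel E3 j t = dy k ^ 3 * blockKernel E3 (j - k) (dy k • t) := by
  rw [blockKernel_eq_scale j, blockKernel_eq_scale (j - k), finrank_euclideanSpace_fin, smul_smul, dy]
  rw [show (2 : ℝ) ^ (j - k) * (2 : ℝ) ^ k = (2 : ℝ) ^ j by rw [← zpow_add₀ two_ne_zero]; simp]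
  rw [← mul_assoc]
  congr 1
  rw [show ((2 : ℝ) ^ k) ^ 3 = (2 : ℝ) ^ (3 * k) by rw [← zpow_natCast, ← zpow_mul]; ring_nf,
    ← zpow_add₀ two_ne_zero]
  push_cast
  ring_nf
/-- **Dilation covariance of the Littlewood–Paley blocks**: `Δ_j (v(2^k ·))(x) = (Δ_{j-k} v)(2^k x)`. -/
theorem blockFn_dil (j k : ℤ) (v : E3 → E3) (x : E3) :
    blockFn j (dil k v) x = blockFn (j - k) v (dy k • x) := by
  rw [blockFn_apply, blockFn_apply]
  have h1 : (fun t => blockKernel E3 j t • dil k v (x - t)) =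
      fun t => dy k ^ 3 • (fun s => blockKernel E3 (j - k) s • v (dy k • x - s)) (dy k • t) := by
    funext t
    simp only [dil, blockKernel_shift j k t, smul_sub, smul_smul]
  rw [h1, integral_smul, Measure.integral_comp_smul_of_nonneg volume
    (fun s => blockKernel E3 (j - k) s • v (dy k • x - s)) (dy k) (hR := (dyk_pos k).le), finrank_euclideanSpace_fin,
    smul_smul, show dy k ^ 3 * (dy k ^ 3)⁻¹ = 1 from mul_inv_cancel₀ (pow_ne_zero 3 (dyk_pos k).ne'),
    one_smul]
/-- The same, as an identity of functions: `Δ_j (v(2^k ·)) = (Δ_{j-k} v)(2^k ·)`. -/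
theorem blockFn_dil' (j k : ℤ) (v : E3 → E3) : blockFn j (dil k v) = dil k (blockFn (j - k) v) :=
  funext (blockFn_dil j k v)
/-- Push-forward of Lebesgue measure under `x ↦ 2^k x`. -/
theorem lintegral_dil (k : ℤ) (g : E3 → ℝ≥0∞) :
    ∫⁻ x, g (dy k • x) = ENNReal.ofReal ((dy k ^ 3)⁻¹) * ∫⁻ y, g y := by
  have hc : dy k ≠ 0 := (dyk_pos k).ne'
  have h := lintegral_map_equiv g (dilEquiv k).toHomeomorph.toMeasurableEquiv (μ := volume)
  have he : ((dilEquiv k).toHomeomorph.toMeasurableEquiv : E3 → E3) = fun x => dy k • x := rfl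
  rw [he] at h; simp only at h
  rw [← h, Measure.map_addHaar_smul volume hc, lintegral_smul_measure, finrank_euclideanSpace_fin,
    abs_of_pos (inv_pos.2 (pow_pos (dyk_pos k) 3)), smul_eq_mul]
/-- `‖Δ_j v(2^k·)‖²₂ = 2^{-3k} ‖Δ_{j-k} v‖²₂`. -/
theorem blockL2E_dil (j k : ℤ) (v : E3 → E3) :
    blockL2E j (dil k v) = ENNReal.ofReal ((dy k ^ 3)⁻¹) * blockL2E (j - k) v := by
  unfold blockL2E; simp_rw [blockFn_dil j k v]
  exact lintegral_dil k (fun y => ‖blockFn (j - k) v y‖ₑ ^ 2)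
/-- The Frobenius pairing is bilinear: scalars pull out. -/
theorem frobPair_smul (a b : ℝ) (A B : E3 →L[ℝ] E3) :
    frobPair (a • A) (b • B) = a * b * frobPair A B := by
  unfold frobPair; rw [Finset.mul_sum]
  refine Finset.sum_congr rfl fun i _ => ?_
  rw [show (a • A) (EuclideanSpace.single i (1 : ℝ)) = a • A (EuclideanSpace.single i (1 : ℝ)) from rfl,
    show (b • B) (EuclideanSpace.single i (1 : ℝ)) = b • B (EuclideanSpace.single i (1 : ℝ)) from rfl,
    real_inner_smul_left, real_inner_smul_right]
  ring
/-- `⟨∇Δ_j(a f), ∇Δ_j(b g)⟩ = ab ⟨∇Δ_j f, ∇Δ_j g⟩`. -/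
theorem gradBlockPair_smul (j : ℤ) (a b : ℝ) (f g : E3 → E3) :
    gradBlockPair j (a • f) (b • g) = a * b * gradBlockPair j f g := by
  unfold gradBlockPair
  rw [blockFn_smul, blockFn_smul, fderiv_const_smul_field, fderiv_const_smul_field, ← integral_const_mul]
  refine integral_congr_ae (Eventually.of_forall fun x => ?_)
  simp only [Pi.smul_apply, frobPair_smul]
/-- `⟨∇Δ_j f(2^k·), ∇Δ_j g(2^k·)⟩ = 2^{-k} ⟨∇Δ_{j-k} f, ∇Δ_{j-k} g⟩`. -/
theorem gradBlockPair_dil (j k : ℤ) (f g : E3 → E3) :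
    gradBlockPair j (dil k f) (dil k g) = (dy k)⁻¹ * gradBlockPair (j - k) f g := by
  have hc : 0 < dy k := dyk_pos k
  unfold gradBlockPair
  rw [blockFn_dil', blockFn_dil']
  simp_rw [fderiv_dil, frobPair_smul]
  rw [integral_const_mul, Measure.integral_comp_smul_of_nonneg volume
    (fun y => frobPair (fderiv ℝ (blockFn (j - k) f) y) (fderiv ℝ (blockFn (j - k) g) y)) (dy k)
    (hR := hc.le), finrank_euclideanSpace_fin, smul_eq_mul, ← mul_assoc]
  congr 1; field_simp
/-- `curl (v(2^k ·)) = 2^k (curl v)(2^k ·)`. -/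
theorem curl_dil (k : ℤ) (v : E3 → E3) : curl (dil k v) = dy k • dil k (curl v) := by
  funext x
  rw [Pi.smul_apply, show dil k (curl v) x = curl v (dy k • x) from rfl, curl_eq_curlCLM,
    curl_eq_curlCLM, fderiv_dil, map_smul]
/-- Reindexing a sum over `ℤ` by the shift `j = i + k` (no summability needed). -/
theorem tsum_shift (k : ℤ) (F : ℤ → ℝ) : ∑' j, F j = ∑' i, F (i + k) :=
  ((Equiv.addRight k).tsum_eq F).symm
/-- **Exact scaling of the viscous form**: `Visc(v(2^k ·)) = 2^k · Visc(v)`. -/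
theorem viscForm_dil (p : Params) (ν : ℝ) (k : ℤ) (v : E3 → E3) :
    viscForm p ν (dil k v) = dy k * viscForm p ν v := by
  have hc : dy k ≠ 0 := (dyk_pos k).ne'
  unfold viscForm
  rw [curl_dil]
  have e1 : (∑' j, dy j ^ 2 * gradBlockPair j (dil k v) (dil k v)) =
      dy k * ∑' i, dy i ^ 2 * gradBlockPair i v v := by
    rw [tsum_shift k, ← tsum_mul_left]
    refine tsum_congr fun i => ?_
    rw [gradBlockPair_dil, add_sub_cancel_right, dy_add]
    field_simp
  have e2 : (∑' j, gradBlockPair j (dy k • dil k (curl v)) (dy k • dil k (curl v))) =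
      dy k * ∑' i, gradBlockPair i (curl v) (curl v) := by
    rw [tsum_shift k, ← tsum_mul_left]
    refine tsum_congr fun i => ?_
    rw [gradBlockPair_smul, gradBlockPair_dil, add_sub_cancel_right]
    field_simp
  have e3 : (∑' j, dy j * gradBlockPair j (dil k v) (dy k • dil k (curl v))) =
      dy k * ∑' i, dy i * gradBlockPair i v (curl v) := by
    rw [tsum_shift k, ← tsum_mul_left]
    refine tsum_congr fun i => ?_
    rw [show dil k v = (1 : ℝ) • dil k v from (one_smul _ _).symm, gradBlockPair_smul,
      one_mul, gradBlockPair_dil, add_sub_cancel_right, dy_add]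
    field_simp
  rw [e1, e2, e3]
  ring
/-- One block of the dilate already carries `log 2 · 2^{3 i₀} ‖Δ_{i₀} v‖²₂` of the `H`-seminorm. -/
theorem hNormE_dil_ge (i₀ k : ℤ) (v : E3 → E3) :
    ENNReal.ofReal (Real.log 2 * dy i₀ ^ 3) * blockL2E i₀ v ≤ hNormE (dil k v) := by
  obtain ⟨hi, hk⟩ := And.intro (dyk_pos i₀) (dyk_pos k)
  have h2 : Real.log 2 ≤ Real.log (2 + dy i₀ * dy k) := Real.log_le_log two_pos (by nlinarith)
  have hW0 : 0 ≤ hWeight (i₀ + k) := by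
    unfold hWeight
    exact mul_nonneg (Real.log_nonneg (by linarith [dyk_pos (i₀ + k)])) (pow_nonneg (dyk_pos _).le 3)
  have hreal : Real.log 2 * dy i₀ ^ 3 ≤ hWeight (i₀ + k) * (dy k ^ 3)⁻¹ := by
    rw [hWeight, dy_add, mul_pow, show Real.log (2 + dy i₀ * dy k) * (dy i₀ ^ 3 * dy k ^ 3)
      * (dy k ^ 3)⁻¹ = Real.log (2 + dy i₀ * dy k) * dy i₀ ^ 3 by field_simp]
    exact mul_le_mul_of_nonneg_right h2 (pow_nonneg hi.le 3)
  calc ENNReal.ofReal (Real.log 2 * dy i₀ ^ 3) * blockL2E i₀ v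
      ≤ ENNReal.ofReal (hWeight (i₀ + k) * (dy k ^ 3)⁻¹) * blockL2E i₀ v :=
        mul_le_mul_of_nonneg_right (ENNReal.ofReal_le_ofReal hreal) bot_le
    _ = ENNReal.ofReal (hWeight (i₀ + k)) * blockL2E (i₀ + k) (dil k v) := by
        rw [blockL2E_dil, add_sub_cancel_right, ← mul_assoc, ENNReal.ofReal_mul hW0]
    _ ≤ hNormE (dil k v) := ENNReal.le_tsum (i₀ + k)
/-- A test field with a non-zero Littlewood–Paley block (Gavrilov's compactly supported steady
Euler flow, via `‖v‖²₂ ≤ 2 Σ_j ‖Δ_j v‖²₂`). -/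
theorem exists_testField_block_ne_zero :
    ∃ v : E3 → E3, IsTestField v ∧ ∃ i₀ : ℤ, blockL2E i₀ v ≠ 0 := by
  obtain ⟨U, P, hU, -, hUc, -, hU0, -, -, -, -, hdiv, -, -⟩ :=
    gavrilov_compact_steady_euler_holds 1 one_pos 1 one_pos
  refine ⟨U, ⟨hU, hUc, hdiv⟩, ?_⟩
  by_contra! h
  have hmem : MemLp U 2 volume := hU.continuous.memLp_of_hasCompactSupport hUc
  have hLP := eLpNorm_sq_le_two_mul_tsum_eLpNorm_blockFn_sq (E := E3) hmem
  have hblock : ∀ j : ℤ, eLpNorm (blockFn j U) 2 volume = 0 := by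
    intro j
    have h0 : blockFn j U =ᵐ[volume] 0 := by
      have hj := h j
      rw [blockL2E, lintegral_eq_zero_iff'
        ((aestronglyMeasurable_blockFn j hmem.1).enorm.pow_const 2)] at hj
      filter_upwards [hj] with x hx
      simpa using hx
    rw [eLpNorm_congr_ae h0, eLpNorm_zero]
  have hz : (∑' j : ℤ, eLpNorm (blockFn j U) 2 volume ^ 2) = 0 := by simp [hblock]
  rw [hz, mul_zero, nonpos_iff_eq_zero, pow_eq_zero_iff two_ne_zero] at hLP
  have hae : U =ᵐ[volume] 0 := (eLpNorm_eq_zero_iff hmem.1 two_ne_zero).1 hLP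
  exact hU0 ((hU.continuous.ae_eq_iff_eq volume continuous_const).1 hae)
/-- The common end of both refutations: a fixed positive multiple of a non-zero block cannot stay
below `2^k |V|` for all `k ∈ ℤ`. -/
theorem no_uniform_bound {K : ℝ} (hK : 0 < K) {B : ℝ≥0∞} (hB : B ≠ 0) (V : ℝ)
    (hk : ∀ k : ℤ, ENNReal.ofReal K * B ≤ ENNReal.ofReal (dy k * |V|)) : False := by
  rcases eq_or_ne B ⊤ with htop | hfin
  · have := hk 0
    rw [htop, ENNReal.mul_top (by simpa using hK)] at this
    exact absurd this (by simp)
  · set b : ℝ := B.toReal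
    have hb : 0 < b := ENNReal.toReal_pos hB hfin
    obtain ⟨N, hN⟩ := exists_pow_lt_of_lt_one (show 0 < K * b / (|V| + 1) by positivity)
      (show (1 / 2 : ℝ) < 1 by norm_num)
    have := hk (-(N : ℤ))
    rw [← ENNReal.ofReal_toReal hfin, ← ENNReal.ofReal_mul hK.le] at this
    have hlt : dy (-(N : ℤ)) * |V| < K * b := by
      rw [show dy (-(N : ℤ)) = (1 / 2 : ℝ) ^ N by rw [dy, zpow_neg, zpow_natCast, one_div, inv_pow]]
      calc (1 / 2 : ℝ) ^ N * |V| ≤ (1 / 2 : ℝ) ^ N * (|V| + 1) := by gcongr; linarith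
        _ < K * b / (|V| + 1) * (|V| + 1) := by gcongr
        _ = K * b := by field_simp
    exact absurd ((ENNReal.ofReal_le_ofReal_iff (mul_nonneg (dyk_pos _).le (abs_nonneg V))).1 this)
      (not_le.2 hlt)
/-- **`¬ Step_A6`**: the viscous gain (A.6) fails along the dilates `U(2^{-N} ·)` of one test field. -/
theorem not_Step_A6 : ¬ Literature.Claims.NS.Tennant2025.Step_A6 := by
  intro h
  obtain ⟨c₀, hc₀, hA⟩ := h baseParams baseParams_admissible
  obtain ⟨v, hv, i₀, hi₀⟩ := exists_testField_block_ne_zero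
  have hKpos : 0 < c₀ * (Real.log 2 * dy i₀ ^ 3) := by
    have := dyk_pos i₀; have := Real.log_pos one_lt_two; positivity
  refine no_uniform_bound hKpos hi₀ (viscForm baseParams 1 v) fun k => ?_
  have h1 := hA 1 one_pos (dil k v) (isTestField_dil k hv)
  rw [viscForm_dil, mul_one] at h1
  calc ENNReal.ofReal (c₀ * (Real.log 2 * dy i₀ ^ 3)) * blockL2E i₀ v
      = ENNReal.ofReal c₀ * (ENNReal.ofReal (Real.log 2 * dy i₀ ^ 3) * blockL2E i₀ v) := by
        rw [ENNReal.ofReal_mul hc₀.le, mul_assoc]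
    _ ≤ ENNReal.ofReal c₀ * hNormE (dil k v) := by gcongr; exact hNormE_dil_ge i₀ k v
    _ ≤ ENNReal.ofReal (-(dy k * viscForm baseParams 1 v)) := h1
    _ ≤ ENNReal.ofReal (dy k * |viscForm baseParams 1 v|) :=
        ENNReal.ofReal_le_ofReal (by nlinarith [neg_le_abs (viscForm baseParams 1 v), dyk_pos k])
/-- **`¬ Step_A5`**, for free: the skeleton proves `Step_L23` and `Step_L23 → Step_A5 → Step_A6`. -/
theorem not_Step_A5 : ¬ Literature.Claims.NS.Tennant2025.Step_A5 := fun h5 =>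
  not_Step_A6 (stepA6_of_L23_A5 step_L23_holds h5)
/-- `((v(2^k·))·∇)(v(2^k·)) = 2^k ((v·∇)v)(2^k·)`. -/
theorem convect_dil (k : ℤ) (v : E3 → E3) :
    convect (dil k v) (dil k v) = dy k • dil k (convect v v) := by
  funext x
  show fderiv ℝ (dil k v) x (dil k v x) = dy k • (fderiv ℝ v (dy k • x) (v (dy k • x)))
  rw [fderiv_dil]; rfl
/-- `curl (c F) = c curl F` (no differentiability needed). -/
theorem curl_const_smul' (c : ℝ) (F : E3 → E3) : curl (c • F) = c • curl F := by
  funext x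
  rw [Pi.smul_apply, curl_eq_curlCLM, curl_eq_curlCLM, fderiv_const_smul_field, Pi.smul_apply,
    map_smul]
/-- `⟨Δ_j(a f), Δ_j(b g)⟩ = ab ⟨Δ_j f, Δ_j g⟩`. -/
theorem blockPair_smul (j : ℤ) (a b : ℝ) (f g : E3 → E3) :
    blockPair j (a • f) (b • g) = a * b * blockPair j f g := by
  unfold blockPair
  rw [blockFn_smul, blockFn_smul, ← integral_const_mul]
  refine integral_congr_ae (Eventually.of_forall fun x => ?_)
  simp only [Pi.smul_apply, real_inner_smul_left, real_inner_smul_right]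
  ring
/-- `⟨Δ_j f(2^k·), Δ_j g(2^k·)⟩ = 2^{-3k} ⟨Δ_{j-k} f, Δ_{j-k} g⟩`. -/
theorem blockPair_dil (j k : ℤ) (f g : E3 → E3) :
    blockPair j (dil k f) (dil k g) = (dy k ^ 3)⁻¹ * blockPair (j - k) f g := by
  have hc : 0 < dy k := dyk_pos k
  unfold blockPair
  rw [blockFn_dil', blockFn_dil']; simp only [dil]
  rw [Measure.integral_comp_smul_of_nonneg volume
    (fun y => ⟪blockFn (j - k) f y, blockFn (j - k) g y⟫) (dy k) (hR := hc.le), finrank_euclideanSpace_fin, smul_eq_mul]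
/-- **The nonlinear form is exactly invariant** under `v ↦ v(2^k ·)`. -/
theorem nonlinForm_dil (p : Params) (k : ℤ) (v : E3 → E3) :
    nonlinForm p (dil k v) = nonlinForm p v := by
  have hc : dy k ≠ 0 := (dyk_pos k).ne'
  unfold nonlinForm
  rw [convect_dil, curl_dil, curl_const_smul', curl_dil, smul_smul]
  have e1 : (∑' j, dy j ^ 2 * blockPair j (dy k • dil k (convect v v)) (dil k v)) =
      ∑' i, dy i ^ 2 * blockPair i (convect v v) v := by
    rw [tsum_shift k]
    refine tsum_congr fun i => ?_
    rw [show dil k v = (1 : ℝ) • dil k v from (one_smul _ _).symm, blockPair_smul, blockPair_dil,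
      add_sub_cancel_right, dy_add]
    field_simp
  have e2 : (∑' j, blockPair j ((dy k * dy k) • dil k (curl (convect v v))) (dy k • dil k (curl v))) =
      ∑' i, blockPair i (curl (convect v v)) (curl v) := by
    rw [tsum_shift k]
    refine tsum_congr fun i => ?_
    rw [blockPair_smul, blockPair_dil, add_sub_cancel_right]
    field_simp
  have e3 : (∑' j, dy j * (blockPair j (dy k • dil k (convect v v)) (dy k • dil k (curl v))
      + blockPair j (dil k v) ((dy k * dy k) • dil k (curl (convect v v))))) =
      ∑' i, dy i * (blockPair i (convect v v) (curl v) + blockPair i v (curl (convect v v))) := by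
    rw [tsum_shift k]
    refine tsum_congr fun i => ?_
    rw [blockPair_smul, blockPair_dil, show dil k v = (1 : ℝ) • dil k v from (one_smul _ _).symm,
      blockPair_smul, blockPair_dil, add_sub_cancel_right, dy_add]
    field_simp
  rw [e1, e2, e3]
/-- `curl (-v) = -curl v`. -/
theorem curl_neg' (v : E3 → E3) : curl (-v) = -curl v := by
  funext x
  rw [Pi.neg_apply, curl_eq_curlCLM, curl_eq_curlCLM, fderiv_neg, map_neg]
/-- `((-v)·∇)(-v) = (v·∇)v`. -/
theorem convect_neg (v : E3 → E3) : convect (-v) (-v) = convect v v := by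
  funext x
  simp [convect, fderiv_neg]
/-- `⟨Δ_j(-f), Δ_j g⟩ = -⟨Δ_j f, Δ_j g⟩`. -/
theorem blockPair_neg_left (j : ℤ) (f g : E3 → E3) : blockPair j (-f) g = -blockPair j f g := by
  rw [show -f = (-1 : ℝ) • f by simp, show g = (1 : ℝ) • g by simp, blockPair_smul, one_smul]
  ring
/-- `⟨Δ_j f, Δ_j(-g)⟩ = -⟨Δ_j f, Δ_j g⟩`. -/
theorem blockPair_neg_right (j : ℤ) (f g : E3 → E3) : blockPair j f (-g) = -blockPair j f g := by
  rw [show -g = (-1 : ℝ) • g by simp, show f = (1 : ℝ) • f by simp, blockPair_smul, one_smul]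
  ring
/-- The nonlinear form is odd: `Nonlin(-v) = -Nonlin(v)`. -/
theorem nonlinForm_neg (p : Params) (v : E3 → E3) : nonlinForm p (-v) = -nonlinForm p v := by
  unfold nonlinForm
  rw [convect_neg, curl_neg']
  have e1 : (∑' j, dy j ^ 2 * blockPair j (convect v v) (-v)) =
      -∑' j, dy j ^ 2 * blockPair j (convect v v) v := by
    rw [← tsum_neg]; exact tsum_congr fun j => by rw [blockPair_neg_right]; ring
  have e2 : (∑' j, blockPair j (curl (convect v v)) (-curl v)) =
      -∑' j, blockPair j (curl (convect v v)) (curl v) := by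
    rw [← tsum_neg]; exact tsum_congr fun j => blockPair_neg_right _ _ _
  have e3 : (∑' j, dy j * (blockPair j (convect v v) (-curl v) + blockPair j (-v) (curl (convect v v)))) =
      -∑' j, dy j * (blockPair j (convect v v) (curl v) + blockPair j v (curl (convect v v))) := by
    rw [← tsum_neg]
    exact tsum_congr fun j => by rw [blockPair_neg_right, blockPair_neg_left]; ring
  rw [e1, e2, e3]
  ring
/-- The viscous form is even: `Visc(-v) = Visc(v)`. -/
theorem viscForm_neg (p : Params) (ν : ℝ) (v : E3 → E3) : viscForm p ν (-v) = viscForm p ν v := by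
  unfold viscForm
  rw [curl_neg', show -v = (-1 : ℝ) • v by simp, show -curl v = (-1 : ℝ) • curl v by simp]
  simp only [gradBlockPair_smul]
  norm_num
/-- Blocks norms are even. -/
theorem blockL2E_neg (j : ℤ) (v : E3 → E3) : blockL2E j (-v) = blockL2E j v := by
  unfold blockL2E; rw [blockFn_neg]; simp
/-- **`¬ CoerciveSlice`**: the assembled one-time-slice form of Theorem 2.5 / Theorem A.5
(`(c₀/2) ν ‖u‖²_H ≤ −(Visc + Nonlin)` on the data class) fails: `Nonlin` is invariant and `Visc`
scales like `2^k` under `u ↦ u(2^k ·)`, while one block of `‖u‖²_H` persists; the sign of `Nonlin`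
is fixed by `u ↦ −u`. -/
theorem not_CoerciveSlice : ¬ Literature.Claims.NS.Tennant2025.CoerciveSlice := by
  intro h
  obtain ⟨p, -, c₀, hc₀, hA⟩ := h 1 one_pos
  obtain ⟨v, hv, i₀, hi₀⟩ := exists_testField_block_ne_zero
  obtain ⟨w, hw, hwB, hN⟩ : ∃ w : E3 → E3, IsTestField w ∧ blockL2E i₀ w = blockL2E i₀ v ∧
      0 ≤ nonlinForm p w := by
    rcases le_or_gt 0 (nonlinForm p v) with h0 | h0
    · exact ⟨v, hv, rfl, h0⟩
    · exact ⟨-v, isTestField_neg hv, blockL2E_neg i₀ v, by rw [nonlinForm_neg]; linarith⟩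
  have hKpos : 0 < c₀ / 2 * (Real.log 2 * dy i₀ ^ 3) := by
    have := dyk_pos i₀; have := Real.log_pos one_lt_two; positivity
  refine no_uniform_bound hKpos hi₀ (viscForm p 1 w) fun k => ?_
  have h1 := hA (dil k w) (isTestField_dil k hw)
  rw [viscForm_dil, nonlinForm_dil, mul_one] at h1
  calc ENNReal.ofReal (c₀ / 2 * (Real.log 2 * dy i₀ ^ 3)) * blockL2E i₀ v
      = ENNReal.ofReal (c₀ / 2) * (ENNReal.ofReal (Real.log 2 * dy i₀ ^ 3) * blockL2E i₀ w) := by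
        rw [ENNReal.ofReal_mul (by positivity), mul_assoc, hwB]
    _ ≤ ENNReal.ofReal (c₀ / 2) * hNormE (dil k w) := by gcongr; exact hNormE_dil_ge i₀ k w
    _ ≤ ENNReal.ofReal (-(dy k * viscForm p 1 w + nonlinForm p w)) := h1
    _ ≤ ENNReal.ofReal (dy k * |viscForm p 1 w|) :=
        ENNReal.ofReal_le_ofReal (by nlinarith [neg_le_abs (viscForm p 1 w), dyk_pos k])
end Summit.NavierStokesRegularity.NavierStokesRegularity.Theorems.Tennant2025

end
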